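import Literature.Computability.Complexity.RandomizingPolynomialsBDD
import Literature.Computability.Complexity.PolynomialEntropyApproximation
import HarnessLib

/-!
# Route SzkEntropy, crux `PeaThreeNotInP` (stmt-PneNP-10776), line `SketchIdeator3`, socket rider:
# raw-level functions of the branching-program socket (definitions only)

The socket rider (card `entropy-gap-sockets`, merged into line `SketchIdeator3` by TRIAGE-r1-1)
certifies, over the tree's degree-3 perfect encoding of deterministic branching programs
(`encodeBDDs`, `encodeBDDsMap`, `entropy_encodeBDDsMap` — Applebaum–Ishai–Kushilevitz Lemma 4.15,
Dvir–Gutfreund–Rothblum–Vadhan Thm 4.5 / Claim 4.4), the reductions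

  `PEABP ≤ₚ PEA 3`,  `PEDBP ≤ₚ PED 3`  (DGRV Thm 4.6)   and   `PEA d ≤ₚ PEABP`  (parity programs),

where `PEABP` / `PEDBP` (entropy approximation / difference for branching-program samplers, raw
node-list instances `RawBP = List (ℕ × ℕ × ℕ × ℕ)`) are the Literature definitions of
`Literature/Computability/Complexity/BranchingProgramEntropy.lean`; hence
`PeaThreeNotInP ↔ PEABP ∉ PromiseP` and `PEDBP ∉ PromiseP → PeaThreeNotInP`.

This file fixes the RAW-DATA FUNCTIONS (plain lists of naturals, the format the `CodeFP` kit reads)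
shared by the socket's stubs, so that the `CodeFP` stubs and the semantic stubs speak about the same
terms:

* §1 `nodeOKRaw`, `validRaw` (validity of a raw program over `n` variables: non-empty, decision
  nodes test a variable `< n` and point to earlier nodes), `symNodeRaw`, `symBPRaw`, `symFalseRaw`
  (the symbolic matrix `L` of AIK Fact 4.13 / Lemma 4.15 read off raw nodes; root = last node;
  the one-node 0-sink for invalid programs), `sizeRaw`, `encodeBDDRaw` (= `gBlock` of the symbolic
  matrix), `encodeBDDsRaw` (consecutive fresh blocks, as `encodeBDDs`), `toPEARaw` (raw data of the
  instance map `PEABP → PEA 3`, `(n, Bs, k) ↦ (n + m, P', k + m)`).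
* §2 `chainRaw`, `parityStep`, `parityRaw` — the PARITY PROGRAM of a sparse polynomial over `F₂`
  (a width-2 layered program: per non-empty monomial two decision chains, one per accumulated
  parity; empty monomials absorbed into the two sinks; root = last node), `toPEABPRaw` (raw data of
  the instance map `PEA d → PEABP`, `(n, P, k) ↦ (n, P.map parityRaw, k)`).
* §3 decidable sanity checks (`socketRawDefs_sanity`).

Raw node format: `(tag, x, lo, hi)`, `tag = 0` the 0-sink, `tag = 1` the 1-sink, `tag ≥ 2` a
decision node testing `x` with 0-successor `lo` and 1-successor `hi`; node `i` = entry `i`.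
Definitions only; the facts (`CodeFP` programs, agreement with `encodeBDDs ∘ compile`, semantics
of `parityRaw`) are the socket's stub files `SzkEntropyPeaThreeNotInPSocket*.lean`.
Sources: B. Applebaum, Y. Ishai, E. Kushilevitz, SIAM J. Comput. 36 (2006) §4.3; Z. Dvir,
D. Gutfreund, G. N. Rothblum, S. Vadhan, ECCC TR10-160 (2010) §4.2; I. Wegener, *Branching
programs and binary decision diagrams*, SIAM 2000, §1.1 (parity as a width-2 program).
-/

namespace Summit.PneNP.PneNP.Cruxes.PeaThreeNotInP.SocketBP

set_option linter.dupNamespace false -- `Summit.PneNP.PneNP.…`: summit = sub-problem name (D-0017)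

open Literature.Computability.Complexity Literature.Computability.Complexity.RandPoly

/-! ### §1 The degree-3 encoding read off raw programs -/

/-- Well-formedness of the raw node `nd` at position `i` over `n` variables (the `Bool` of
`RawBP.nodeOK`): a decision node tests a variable `< n` and points to earlier nodes. [folklore] -/
def nodeOKRaw (n i : ℕ) (nd : ℕ × ℕ × ℕ × ℕ) : Bool :=
  decide (nd.1 < 2) || (decide (nd.2.1 < n) && decide (nd.2.2.1 < i) && decide (nd.2.2.2 < i))

/-- Validity of a raw program over `n` variables as a `Bool` (= `decide (RawBP.Valid n B)`):
non-empty and every node well-formed at its position. [folklore] -/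
def validRaw (n : ℕ) (B : List (ℕ × ℕ × ℕ × ℕ)) : Bool :=
  decide (0 < B.length) && ((List.range B.length).all fun i => nodeOKRaw n i (B.getD i (0, 0, 0, 0)))

/-- Out-edges of a raw node as sparse affine polynomials in the input variables — the raw form
of `RandPoly.symNode Fin.val` on the typed node: `s` = number of nodes, column `c`.
[cite: ApplebaumIshaiKushilevitz2006, Lemma 4.15] -/
def symNodeRaw (nd : ℕ × ℕ × ℕ × ℕ) (s c : ℕ) : List (List ℕ) :=
  if nd.1 < 2 then (if c = s ∧ nd.1 = 1 then [[]] else [])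
  else (if c + 1 + nd.2.2.2 = s then [[nd.2.1]] else []) ++
       (if c + 1 + nd.2.2.1 = s then [[], [nd.2.1]] else [])

/-- The symbolic matrix `L` of a VALID raw program (raw form of `RandPoly.symBP` on the compiled
program: `s = |B|` nodes, root `s - 1`, row `r ↦ node s - r`).
[cite: ApplebaumIshaiKushilevitz2006, Lemma 4.15] -/
def symBPRaw (B : List (ℕ × ℕ × ℕ × ℕ)) (r c : ℕ) : List (List ℕ) :=
  (if r = 0 then (if c + 1 + (B.length - 1) = B.length then [[]] else [])
    else if r ≤ B.length ∧ 0 < r then symNodeRaw (B.getD (B.length - r) (0, 0, 0, 0)) B.length c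
    else []) ++
  (if r = c + 1 then [[]] else [])

/-- The symbolic matrix of the one-node 0-sink program (the compiled form of an invalid raw
program). [cite: ApplebaumIshaiKushilevitz2006, Lemma 4.15] -/
def symFalseRaw (r c : ℕ) : List (List ℕ) :=
  (if r = 0 then (if c = 0 then [[]] else []) else []) ++ (if r = c + 1 then [[]] else [])

/-- Number of nodes of the compiled program: `|B|` if valid, `1` otherwise. [folklore] -/
def sizeRaw (n : ℕ) (B : List (ℕ × ℕ × ℕ × ℕ)) : ℕ := if validRaw n B then B.length else 1

/-- The degree-3 block of one raw program with fresh variables from `n₀` (raw form of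
`RandPoly.encodeBDD n₀ (compile n B).2 Fin.val`). [cite: ApplebaumIshaiKushilevitz2006, Lemma 4.15] -/
def encodeBDDRaw (n₀ n : ℕ) (B : List (ℕ × ℕ × ℕ × ℕ)) : List (List (List ℕ)) :=
  if validRaw n B then gBlock n₀ B.length (symBPRaw B) else gBlock n₀ 1 symFalseRaw

/-- The encoding of a list of raw programs with consecutive fresh blocks from `n₀` (raw form of
`RandPoly.encodeBDDs Fin.val n₀ (compileAll n Bs)`): final counter and outputs.
[cite: ApplebaumIshaiKushilevitz2006, Lemma 4.9] -/
def encodeBDDsRaw (n : ℕ) : ℕ → List (List (ℕ × ℕ × ℕ × ℕ)) → ℕ × List (List (List ℕ))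
  | n₀, [] => (n₀, [])
  | n₀, B :: Bs => ((encodeBDDsRaw n (n₀ + pos (sizeRaw n B) (sizeRaw n B)) Bs).1,
      encodeBDDRaw n₀ n B ++ (encodeBDDsRaw n (n₀ + pos (sizeRaw n B) (sizeRaw n B)) Bs).2)

/-- Raw data of the instance map `PEABP → PEA 3`: `(n, Bs, k) ↦ (n', P', k + (n' - n))` with
`(n', P') = encodeBDDsRaw n n Bs` (`n' - n` = number of random bits).
[cite: DvirGutfreundRothblumVadhan2010, Thm 4.6] -/
def toPEARaw (c : ℕ × List (List (ℕ × ℕ × ℕ × ℕ)) × ℕ) : ℕ × List (List (List ℕ)) × ℕ :=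
  ((encodeBDDsRaw c.1 c.1 c.2.1).1, (encodeBDDsRaw c.1 c.1 c.2.1).2,
    c.2.2 + ((encodeBDDsRaw c.1 c.1 c.2.1).1 - c.1))

/-! ### §2 The parity program of a sparse polynomial -/

/-- The decision chain of a non-empty monomial `μ = [x₁, …, x_d]`, emitted from node index `start`:
chain node `j` (`0`-based) tests `x_{d-j}`; its 0-successor is `kb` ("the monomial vanishes: keep
the accumulated parity"), its 1-successor the previous chain node (`kf` = "flip" for `j = 0`).
The entry of the chain (the test of `x₁`) is the node `start + d - 1`.
[Wegener 2000, §1.1] [folklore] -/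
def chainRaw (μ : List ℕ) (start kb kf : ℕ) : List (ℕ × ℕ × ℕ × ℕ) :=
  (μ.reverse.zipIdx).map fun xj => (2, xj.1, kb, if xj.2 = 0 then kf else start + xj.2 - 1)

/-- One monomial of the parity program: on the state `(nodes so far, k0, k1)` (`k_b` = the node
computing the rest at accumulated parity `b`) emit the chain for parity `1` (keep `k1`, flip to
`k0`) and then the chain for parity `0` (keep `k0`, flip to `k1`); the new continuations are the
two chain entries. [Wegener 2000, §1.1] [folklore] -/
def parityStep (st : List (ℕ × ℕ × ℕ × ℕ) × ℕ × ℕ) (μ : List ℕ) :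
    List (ℕ × ℕ × ℕ × ℕ) × ℕ × ℕ :=
  let s := st.1.length
  let d := μ.length
  (st.1 ++ chainRaw μ s st.2.2 st.2.1 ++ chainRaw μ (s + d) st.2.1 st.2.2, s + 2 * d - 1, s + d - 1)

/-- **The parity program of a sparse polynomial** `p` over `F₂` (a list of monomials, variables as
naturals): node `0` = the sink reached at accumulated parity `1`, node `1` = the sink reached at
accumulated parity `0` (their labels absorb the number of EMPTY monomials, i.e. constant `1`s),
then the chains of the non-empty monomials, last monomial first, so that the root — the entry of
the first monomial at parity `0` — is the last node.  It computes `x ↦ [∑_{μ ∈ p} ∏_{i ∈ μ} xᵢ = 1]`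
with `2 + 2 · ∑_μ |μ|` nodes. [Wegener 2000, §1.1 (parity / linear functions have width-2 OBDDs)] [folklore] -/
def parityRaw (p : List (List ℕ)) : List (ℕ × ℕ × ℕ × ℕ) :=
  let odd : Bool := decide ((p.filter fun μ => μ.isEmpty).length % 2 = 1)
  let q := p.filter fun μ => !μ.isEmpty
  (q.reverse.foldl parityStep
    ([(if odd then 0 else 1, 0, 0, 0), (if odd then 1 else 0, 0, 0, 0)], 1, 0)).1

/-- Raw data of the instance map `PEA d → PEABP`: `(n, P, k) ↦ (n, P.map parityRaw, k)`.
[folklore] -/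
def toPEABPRaw (c : ℕ × List (List (List ℕ)) × ℕ) : ℕ × List (List (ℕ × ℕ × ℕ × ℕ)) × ℕ :=
  (c.1, c.2.1.map parityRaw, c.2.2)

/-! ### §3 Sanity checks (decidable) -/

/-- **Sanity of the raw definitions** on the polynomial `x₀x₁ + x₂` over `3` variables: its parity
program is the expected 8-node program, valid over `3` variables; the 4-node program of `x₀ ∧ x₁`
is valid over `2` variables and the empty program is not; the parity programs of `0` and of `1`
are the two sinks in the two orders. [folklore] -/
theorem socketRawDefs_sanity :
    parityRaw [[0, 1], [2]] =
        [(1,0,0,0), (0,0,0,0), (2,2,0,1), (2,2,1,0), (2,1,2,3), (2,0,2,4), (2,1,3,2), (2,0,3,6)] ∧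
      validRaw 3 (parityRaw [[0, 1], [2]]) = true ∧
      validRaw 2 [(0,0,0,0), (1,0,0,0), (2,1,0,1), (2,0,0,2)] = true ∧
      validRaw 2 [] = false ∧
      parityRaw [] = [(1,0,0,0), (0,0,0,0)] ∧ parityRaw [[]] = [(0,0,0,0), (1,0,0,0)] := by
  decide

end Summit.PneNP.PneNP.Cruxes.PeaThreeNotInP.SocketBP
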